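import Literature.Analysis.FluidPDE.TaoClassGlue
import Literature.Analysis.FluidPDE.NSKatoToClay
import HarnessLib

/-!
# A global Kato solution from a Clay datum is a Clay-class solution — reduction to Tao's
# local existence theorem (`C([0,T]; L³)` is a regularity class, von Wahl)

Analysis/FluidPDE proof file for the named fact
`Literature.Analysis.FluidPDE.clay_solution_of_hasGlobalKatoSolution` (`NSKatoToClay.lean`;
route `NavierStokesRegularity/MinimalBlowupRigidity`, item `…KatoToClay`): for `ν > 0` and a
smooth, divergence-free, rapidly decaying datum `u₀` admitting a global Kato solution
`w ∈ C([0, ∞); L³)` (`HasGlobalKatoSolution ν u₀`), there are jointly smooth `u`, `p` on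
`ℝ³ × [0, ∞)` solving the Navier–Stokes system with datum `u₀` and with bounded energy.

This file proves

* `clay_solution_of_hasGlobalKatoSolution_of_tao :
    tao2011_smooth_local_existence → clay_solution_of_hasGlobalKatoSolution`,

i.e. it reduces the fact to the single named fact `tao2011_smooth_local_existence`
(`TaoH1LocalExistence.lean`; Tao 2013, Thm. 5.4 (ii)+(iv): local existence of smooth solutions
with all Sobolev norms bounded, from smooth divergence-free `H^∞` data, on a time interval of
length `c ν³ ‖u₀‖_{H¹}^{-4}` — the standard `H¹` local theory, already the common leaf of
`NSCriticalClosureTao`, `TaoLocalisationContinuation` and `TaoH1LocalExistenceProofs`). Every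
other ingredient is a theorem of the tree.

## The argument (von Wahl 1985; Lemarié-Rieusset 2016, Prop. 12.3, 4th item:
## `C([0,T], L³) ⊂ X_T^{(0)}`, PDF p. 393, with the restart argument of Thm. 7.2, PDF p. 147)

Let `w` be the global Kato solution and fix `T > 0`.

1. *Small `L³` tails.* `{w(t) : t ∈ [0, T + 1]}` is compact in `L³`, so there is a height `λ`
   with `‖w(t) 1_{|w(t)| ≥ λ}‖₃ ≤ δ₀(ν)` for all `t ≤ T + 1`
   (`ContinuousInLpOn.exists_forall_eLpNorm_indicator_le`), `δ₀` the threshold of the enstrophy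
   inequality under an `L³`-small plus bounded splitting (`enstrophy_le_mul_exp_of_split`,
   `EnstrophySplitting.lean`; Lemarié-Rieusset 2016, Thm. 11.2 with Prop. 12.3).
2. *Identification.* A Tao-class solution `(u, p)` on `[0, F]` from `u₀` (`IsTaoSolutionOn`,
   `TaoClassGlue.lean`) is bounded, hence a mild solution in `C([0, F]; L³)`, hence equal a.e.
   to `w` at every time of `[0, F]` by the uniqueness theorem of Furioli–Lemarié-Rieusset–Terraneo
   (`kato_unique_holds`; `IsTaoSolutionOn.ae_eq_of_kato_Icc`).
3. *Uniform `H¹` bound.* Consequently `u(t) = b(t) + (u(t) - b(t))` with `|b(t)| ≤ λ` and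
   `‖u(t) - b(t)‖₃ ≤ δ₀`, and the enstrophy inequality gives
   `∫|∇u(t)|² ≤ e^{2M²t/ν} ∫|∇u₀|²`, `M = max(λ, 1)` (`IsTaoSolutionOn.enstrophy_le_of_tails`);
   with the energy inequality, `‖u(t)‖²_{L²} + ‖∇u(t)‖²_{L²} ≤ A` with `A` depending on
   `u₀, ν, λ, T` only — not on `F ≤ T + 1`.
4. *Restart and glue.* Tao's theorem from the `H^∞` datum `u(t')`, `t' = max(F/2, F - τ/4)`,
   lives for the uniform time `τ = min(1, cν³/(A+1)²)`; by Prodi–Serrin it agrees with `u` on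
   the overlap, and gluing (`IsTaoSolutionOn.glue`: un-renormalised pressures, both in `L²`)
   yields a Tao-class solution on `[0, t' + τ] ⊇ [0, F + τ/2]`. Starting from Tao's solution for
   the Schwartz datum and iterating, `[0, T]` is covered
   (`exists_isTaoSolutionOn_of_hasGlobalKatoSolution`).
5. *Patching `T → ∞`.* Tao-class solutions on `[0, n + 1]`, `n ∈ ℕ`, from `u₀` agree on common
   slabs (velocities by Prodi–Serrin, pressures because both are `L²` with equal gradients —
   also at `t = 0`, `IsTaoSolutionOn.pressure_eq`), so `u t = U_{⌈t⌉} t`, `p t = P_{⌈t⌉} t` is a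
   classical solution on `[0, ∞)` (smoothness and the one-sided momentum equation are local in
   time) with `u 0 = u₀` and `∫|u(t)|² ≤ ∫|u₀|²`; the bridge `isNavierStokesSolution_and_smooth_iff`
   gives Fefferman's form.

## What remains for an unconditional `clay_solution_of_hasGlobalKatoSolution_holds`

Only `tao2011_smooth_local_existence`. Note that the argument above uses Tao's theorem only
for restart data which are slices of solutions constructed from the Schwartz datum `u₀`; a
local existence theorem with `H¹`-controlled lifespan for any restartable class containing the
Schwartz class (e.g. the Fourier class of `NSFourierRestart.FourierDatum` together with an a
priori control of the Fourier-side decay) would serve equally (the marching only uses the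
interface `IsTaoSolutionOn.of_tao`).

## Mathlib / tree search

`lean search 'clay_solution_of_hasGlobalKatoSolution'`: only the fact and its dependent
(`EnstrophySplitting` docstring, the route thesis `MinimalBlowupRigidity`). Reused, not restated:
`enstrophy_le_mul_exp_of_split`, `kato_unique_holds` (via `IsTaoSolutionOn.ae_eq_of_kato`),
`ContinuousInLpOn.exists_forall_eLpNorm_indicator_le`, `ContinuousInLpOn.ae_eq_of_neBot`,
`HasRapidSpatialDecay.lintegral_enorm_iteratedFDeriv_sq_lt_top`,
`ofReal_frobeniusNormSq_le_three_mul_enorm_sq`, `isNavierStokesSolution_and_smooth_iff`,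
`IsGlobalMildSolution.isMildNSSolutionOn`. Mathlib: `contDiffOn_of_locally_contDiffOn`,
`derivWithin_inter`, `Filter.EventuallyEq.derivWithin_eq`, `Nat.le_ceil`, `exists_nat_gt`.

## References

* W. von Wahl, *The Equations of Navier–Stokes and Abstract Parabolic Equations*, Vieweg 1985
  (the regularity class `C([0,T]; L³)`, as cited in Lemarié-Rieusset 2016, Prop. 12.3 [494]).
* P. G. Lemarié-Rieusset, *The Navier–Stokes Problem in the 21st Century*, CRC Press 2016,
  Thm. 7.2 and its proof (PDF p. 147), Thm. 7.7 (PDF p. 169), Thm. 11.2, Prop. 12.3 and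
  Thm. 12.4 (PDF pp. 391–393). [LemarieRieusset2016]
* T. Tao, Anal. PDE 6 (2013) = arXiv:1108.1165, Thm. 5.4 (arXiv Thm. 31, p. 18). [Tao2011]
* T. Kato, Math. Z. 187 (1984), 471–480, Thm. 4 (the statement discharged here, in the form of
  the fact's docstring). [Kato1984]
* G. Furioli, P. G. Lemarié-Rieusset, E. Terraneo, Rev. Mat. Iberoam. 16 (2000), Thm. 1.
-/

noncomputable section

open MeasureTheory Set Function Filter Topology
open scoped ENNReal NNReal ContDiff

namespace Literature.Analysis.FluidPDE

/-! ### The Kato solution on finite slabs -/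

/-- A global Kato solution restricted to `[0, T)`: mild on `[0, T)`, in `C([0, T); L³)` (indeed in
`C(S; L³)` for every `S ⊆ [0, ∞)`), measurable on `(0, T) × ℝ³`. [folklore] -/
theorem HasGlobalKatoSolution.exists_restrict {ν : ℝ}
    {u₀ : EuclideanSpace ℝ (Fin 3) → EuclideanSpace ℝ (Fin 3)}
    (hK : HasGlobalKatoSolution ν u₀) :
    ∃ w : ℝ → EuclideanSpace ℝ (Fin 3) → EuclideanSpace ℝ (Fin 3),
      (∀ T : ℝ, IsMildNSSolutionOn (Ico 0 T) ν 0 u₀ w) ∧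
      (∀ S : Set ℝ, S ⊆ Ici 0 → ContinuousInLpOn S 3 w) ∧ w 0 = u₀ ∧
      ∀ T : ℝ, AEStronglyMeasurable (uncurry w) (volume.restrict (Ioo 0 T ×ˢ univ)) := by
  obtain ⟨w, hmild, hwc, hw0, hwm⟩ := hK
  exact ⟨w, fun T => hmild.isMildNSSolutionOn T, fun S hS => hwc.mono hS, hw0, fun T =>
    hwm.mono_measure (Measure.restrict_mono (Set.prod_mono Ioo_subset_Ioi_self Subset.rfl) le_rfl)⟩

namespace IsTaoSolutionOn

variable {T ν : ℝ} {u₀ : EuclideanSpace ℝ (Fin 3) → EuclideanSpace ℝ (Fin 3)}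
  {u : ℝ → EuclideanSpace ℝ (Fin 3) → EuclideanSpace ℝ (Fin 3)} {p : ℝ → EuclideanSpace ℝ (Fin 3) → ℝ}

/-- **Identification with the Kato solution on the closed slab.** Under the hypotheses of
`ae_eq_of_kato`, if moreover `w ∈ C([0, T]; L³)` (closed interval), then `u t = w t` a.e. also at
`t = T`: the coincidence set of two `C([0,T]; L³)` fields is closed
(`ContinuousInLpOn.ae_eq_of_neBot`). [cite: LemarieRieusset2016, proof of Thm. 7.7, first step, p. 147] -/
theorem ae_eq_of_kato_Icc (h : IsTaoSolutionOn T ν u₀ u p) (hν : 0 < ν) (hT : 0 < T)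
    {w : ℝ → EuclideanSpace ℝ (Fin 3) → EuclideanSpace ℝ (Fin 3)}
    (hw : IsMildNSSolutionOn (Ico 0 T) ν 0 u₀ w)
    (hwc : ContinuousInLpOn (Icc 0 T) 3 w)
    (hwm : AEStronglyMeasurable (uncurry w) (volume.restrict (Ioo 0 T ×ˢ univ))) :
    ∀ t ∈ Icc 0 T, u t =ᵐ[volume] w t := by
  have hIco := h.ae_eq_of_kato hν hw (hwc.mono Ico_subset_Icc_self) hwm
  intro t ht
  rcases ht.2.lt_or_eq with hlt | rfl
  · exact hIco t ⟨ht.1, hlt⟩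
  -- `t = T`: closedness of the coincidence set
  refine ContinuousInLpOn.ae_eq_of_neBot (by norm_num) h.continuousInLpOn_three hwc ht ?_
  have hsub : Ico 0 t ⊆ Icc 0 t ∩ {s | u s =ᵐ[volume] w s} := fun s hs =>
    ⟨Ico_subset_Icc_self hs, hIco s hs⟩
  have hne : (𝓝[Ico 0 t] t).NeBot := by
    rw [← mem_closure_iff_nhdsWithin_neBot, closure_Ico hT.ne]
    exact right_mem_Icc.2 hT.le
  exact hne.mono (nhdsWithin_mono _ hsub)

/-- **The enstrophy of a Tao-class solution along a Kato solution with small `L³` tails.**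
Let `(u, p)` be a Tao-class solution on `[0, T]` which agrees a.e. at every time with a field
`w` whose `L³` tails above height `λ` are at most `δ₀` on `[0, T]`, where `δ₀ = δ₀(ν)` is the
threshold of the enstrophy inequality under an `L³`-small plus bounded splitting
(`enstrophy_le_mul_exp_of_split`, Lemarié-Rieusset 2016, Prop. 12.3 (von Wahl) with Thm. 11.2).
Then, with `M = max λ 1`, `∫ |∇u(t)|² ≤ e^{2M²t/ν} ∫ |∇u₀|²` for all `t ∈ [0, T]`: split
`u(t) = b(t) + (u(t) - b(t))` with `b(t) = u(t) 1_{|u(t)| < λ}` bounded by `λ` and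
`u(t) - b(t) = u(t) 1_{|u(t)| ≥ λ}`, whose `L³` norm is that of `w(t) 1_{|w(t)| ≥ λ}`.
[cite: LemarieRieusset2016, Prop. 12.3 (4th item, von Wahl) with Thm. 11.2] -/
theorem enstrophy_le_of_tails (h : IsTaoSolutionOn T ν u₀ u p) (hT : 0 < T)
    {δ₀ : ℝ}
    (hens : ∀ ⦃T : ℝ⦄, 0 < T →
      ∀ ⦃u : ℝ → EuclideanSpace ℝ (Fin 3) → EuclideanSpace ℝ (Fin 3)⦄
        ⦃p : ℝ → EuclideanSpace ℝ (Fin 3) → ℝ⦄,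
        IsClassicalNSSolutionOn (Icc 0 T) ν 0 u p → HasBoundedSobolevNormsOn (Icc 0 T) u →
        HasBoundedSobolevNormsOn (Icc 0 T) (timeDerivWithin (Icc 0 T) u) →
        (∀ n : ℕ, ∃ C : ℝ≥0, ∀ t ∈ Icc 0 T, ∫⁻ x, ‖iteratedFDeriv ℝ n (p t) x‖ₑ ^ 2 ≤ C) →
        ∀ ⦃M s : ℝ⦄, 0 < M → s ∈ Ioc 0 T →
          ∀ b : ℝ → EuclideanSpace ℝ (Fin 3) → EuclideanSpace ℝ (Fin 3),
            (∀ t ∈ Icc 0 s, AEStronglyMeasurable (b t) volume) →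
            (∀ t ∈ Icc 0 s, ∀ x, ‖b t x‖ ≤ M) →
            (∀ t ∈ Icc 0 s, eLpNorm (fun x => u t x - b t x) 3 volume ≤ ENNReal.ofReal δ₀) →
            ∫⁻ x, ENNReal.ofReal (frobeniusNormSq (fderiv ℝ (u s) x)) ≤
              ENNReal.ofReal (Real.exp (2 * M ^ 2 * s / ν)) *
                ∫⁻ x, ENNReal.ofReal (frobeniusNormSq (fderiv ℝ (u 0) x)))
    {w : ℝ → EuclideanSpace ℝ (Fin 3) → EuclideanSpace ℝ (Fin 3)}
    (hae : ∀ t ∈ Icc 0 T, u t =ᵐ[volume] w t) {lam : ℝ≥0}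
    (htail : ∀ t ∈ Icc 0 T,
      eLpNorm ({x | lam ≤ ‖w t x‖₊}.indicator (w t)) 3 volume ≤ ENNReal.ofReal δ₀) :
    ∀ t ∈ Icc 0 T, ∫⁻ x, ENNReal.ofReal (frobeniusNormSq (fderiv ℝ (u t) x)) ≤
      ENNReal.ofReal (Real.exp (2 * (max (lam : ℝ) 1) ^ 2 * t / ν)) *
        ∫⁻ x, ENNReal.ofReal (frobeniusNormSq (fderiv ℝ u₀ x)) := by
  set M : ℝ := max (lam : ℝ) 1 with hM
  have hMpos : 0 < M := lt_of_lt_of_le one_pos (le_max_right _ _)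
  -- the bounded part `b(t) = u(t) - u(t) 1_{|u(t)| ≥ λ}`
  set b : ℝ → EuclideanSpace ℝ (Fin 3) → EuclideanSpace ℝ (Fin 3) := fun t =>
    u t - {x | lam ≤ ‖u t x‖₊}.indicator (u t) with hb
  have hcont : ∀ t ∈ Icc 0 T, Continuous (u t) := fun t ht =>
    (h.classical.contDiff_velocity ht).continuous
  have hset : ∀ t ∈ Icc 0 T, MeasurableSet {x | lam ≤ ‖u t x‖₊} := fun t ht =>
    measurableSet_le measurable_const (hcont t ht).nnnorm.measurable
  have hbm : ∀ t ∈ Icc 0 T, AEStronglyMeasurable (b t) volume := fun t ht =>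
    ((hcont t ht).measurable.sub (((hcont t ht).measurable).indicator (hset t ht))).aestronglyMeasurable
  have hbM : ∀ t ∈ Icc 0 T, ∀ x, ‖b t x‖ ≤ M := by
    intro t ht x
    simp only [hb, Pi.sub_apply, indicator, mem_setOf_eq]
    split_ifs with hx
    · simp only [sub_self, norm_zero]; exact hMpos.le
    · rw [sub_zero]
      have : ‖u t x‖ < lam := by
        have h' := not_le.1 hx
        exact_mod_cast h'
      exact this.le.trans (le_max_left _ _)
  have hsub : ∀ t, (fun x => u t x - b t x) = {x | lam ≤ ‖u t x‖₊}.indicator (u t) := by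
    intro t
    funext x
    simp only [hb, Pi.sub_apply, sub_sub_cancel]
  have hsmall : ∀ t ∈ Icc 0 T, eLpNorm (fun x => u t x - b t x) 3 volume ≤ ENNReal.ofReal δ₀ := by
    intro t ht
    rw [hsub t]
    have hcongr : {x | lam ≤ ‖u t x‖₊}.indicator (u t) =ᵐ[volume]
        {x | lam ≤ ‖w t x‖₊}.indicator (w t) :=
      (hae t ht).mono fun x hx => by simp only [Set.indicator_apply, mem_setOf_eq, hx]
    rw [eLpNorm_congr_ae hcongr]
    exact htail t ht
  intro t ht
  rcases ht.1.eq_or_lt with rfl | ht0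
  · rw [h.initial]
    simp
  have hts : t ∈ Ioc 0 T := ⟨ht0, ht.2⟩
  have hmain := hens hT h.classical h.sobolev h.sobolev_dt h.sobolev_p hMpos hts b
    (fun s hs => hbm s ⟨hs.1, hs.2.trans ht.2⟩) (fun s hs => hbM s ⟨hs.1, hs.2.trans ht.2⟩)
    (fun s hs => hsmall s ⟨hs.1, hs.2.trans ht.2⟩)
  rwa [h.initial] at hmain

end IsTaoSolutionOn

/-! ### Tao-class solutions of every length from a global Kato solution -/

/-- **`C([0, T]; L³)` is a regularity class** (von Wahl; Lemarié-Rieusset 2016, Prop. 12.3 with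
Thm. 7.2 (restart) and Thm. 7.7 (uniqueness)), in the constructive form needed here. Assume
Tao's local existence theorem (`tao2011_smooth_local_existence`, Tao 2013, Thm. 5.4 (ii)+(iv)).
Let `ν > 0`, let `u₀` be smooth, divergence free and rapidly decaying, and let `u₀` have a global
Kato solution `w ∈ C([0, ∞); L³)`. Then for every `T > 0` there is a Tao-class solution on the
closed slab `[0, T] × ℝ³` from `u₀`. Proof (restart induction): the `L³` tails of `w` are
uniformly small on `[0, T + 1]` (compactness in `L³`,
`ContinuousInLpOn.exists_forall_eLpNorm_indicator_le`); any Tao-class solution from `u₀` on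
`[0, F]`, `F ≤ T + 1`, is the Kato solution (`IsTaoSolutionOn.ae_eq_of_kato_Icc`), so the
enstrophy inequality under the `L³`-small plus bounded splitting
(`IsTaoSolutionOn.enstrophy_le_of_tails`) and the energy inequality bound `‖u(t)‖²_{H¹}` by a
constant `A` independent of `F`; hence Tao's theorem restarts the solution from `u(t')`,
`t' = max(F/2, F - τ/4)`, for the uniform time `τ = min(1, cν³/(A+1)²)`, and gluing
(`IsTaoSolutionOn.glue`) extends it to `[0, t' + τ] ⊇ [0, F + τ/2]`; after finitely many steps
`[0, T]` is covered. [cite: LemarieRieusset2016, Prop. 12.3 (von Wahl) with Thm. 7.2, PDF pp. 147, 393] -/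
theorem exists_isTaoSolutionOn_of_hasGlobalKatoSolution (hE : tao2011_smooth_local_existence)
    {ν : ℝ} (hν : 0 < ν) {u₀ : EuclideanSpace ℝ (Fin 3) → EuclideanSpace ℝ (Fin 3)}
    (hsm : ContDiff ℝ ∞ u₀)
    (hdiv : VectorCalculus.IsDivFree u₀) (hdec : HasRapidSpatialDecay u₀)
    (hK : HasGlobalKatoSolution ν u₀) {Tt : ℝ} (hTt : 0 < Tt) :
    ∃ (u : ℝ → EuclideanSpace ℝ (Fin 3) → EuclideanSpace ℝ (Fin 3))
      (p : ℝ → EuclideanSpace ℝ (Fin 3) → ℝ), IsTaoSolutionOn Tt ν u₀ u p := by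
  obtain ⟨w, hwmild, hwc, hw0, hwm⟩ := hK.exists_restrict
  obtain ⟨c, hc, hloc⟩ := IsTaoSolutionOn.of_tao hE
  obtain ⟨δ₀, hδ₀, hens⟩ := enstrophy_le_mul_exp_of_split hν
  set Tw : ℝ := Tt + 1 with hTw
  have hTtw : Tt < Tw := by rw [hTw]; linarith
  -- `L³` tails of `w` on `[0, Tw]`
  obtain ⟨lam, hlam⟩ := (hwc (Icc 0 Tw) Icc_subset_Ici_self).exists_forall_eLpNorm_indicator_le
    isCompact_Icc (by norm_num : (1 : ℝ≥0∞) ≤ 3) (by norm_num) hδ₀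
  set M : ℝ := max (lam : ℝ) 1 with hM
  have hMpos : 0 < M := lt_of_lt_of_le one_pos (le_max_right _ _)
  -- energy and enstrophy of the datum
  set e₀ : ℝ := 2 * VectorCalculus.kineticEnergy u₀ with he₀
  have he₀0 : 0 ≤ e₀ := mul_nonneg zero_le_two (kineticEnergy_nonneg _)
  have hHinf : ∀ n : ℕ, ∫⁻ x, ‖iteratedFDeriv ℝ n u₀ x‖ₑ ^ 2 < ⊤ :=
    hdec.lintegral_enorm_iteratedFDeriv_sq_lt_top
  have hfrob_le3 : ∀ v : EuclideanSpace ℝ (Fin 3) → EuclideanSpace ℝ (Fin 3),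
      ∫⁻ x, ENNReal.ofReal (frobeniusNormSq (fderiv ℝ v x)) ≤
        3 * ∫⁻ x, ‖iteratedFDeriv ℝ 1 v x‖ₑ ^ 2 := by
    intro v
    calc ∫⁻ x, ENNReal.ofReal (frobeniusNormSq (fderiv ℝ v x))
        ≤ ∫⁻ x, 3 * ‖iteratedFDeriv ℝ 1 v x‖ₑ ^ 2 := lintegral_mono fun x => by
          rw [← ofReal_norm, norm_iteratedFDeriv_one, ofReal_norm]
          exact ofReal_frobeniusNormSq_le_three_mul_enorm_sq _
      _ = 3 * ∫⁻ x, ‖iteratedFDeriv ℝ 1 v x‖ₑ ^ 2 := lintegral_const_mul' _ _ (by simp)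
  have hG₀ : ∫⁻ x, ENNReal.ofReal (frobeniusNormSq (fderiv ℝ u₀ x)) < ⊤ :=
    (hfrob_le3 u₀).trans_lt (ENNReal.mul_lt_top (by simp) (hHinf 1))
  set g₀ : ℝ := (∫⁻ x, ENNReal.ofReal (frobeniusNormSq (fderiv ℝ u₀ x))).toReal with hg₀
  have hg₀0 : 0 ≤ g₀ := ENNReal.toReal_nonneg
  have hg₀eq : ∫⁻ x, ENNReal.ofReal (frobeniusNormSq (fderiv ℝ u₀ x)) = ENNReal.ofReal g₀ := by
    rw [hg₀, ENNReal.ofReal_toReal hG₀.ne]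
  set A : ℝ := e₀ + Real.exp (2 * M ^ 2 * Tw / ν) * g₀ with hA
  have hA0 : 0 ≤ A := by positivity
  have hA1 : 0 ≤ A + 1 := by positivity
  set τ : ℝ := min 1 (c * ν ^ 3 / (A + 1) ^ 2) with hτ
  have hτpos : 0 < τ := lt_min one_pos (by positivity)
  have hτ1 : τ ≤ 1 := min_le_left _ _
  have hτc : (A + 1) ^ 2 * τ ≤ c * ν ^ 3 := by
    calc (A + 1) ^ 2 * τ ≤ (A + 1) ^ 2 * (c * ν ^ 3 / (A + 1) ^ 2) :=
          mul_le_mul_of_nonneg_left (min_le_right _ _) (sq_nonneg _)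
      _ = c * ν ^ 3 := by field_simp
  /- the uniform `H¹` bound for Tao-class solutions from `u₀` on `[0, F]`, `F ≤ Tw` -/
  have hkey : ∀ ⦃F : ℝ⦄ ⦃u : ℝ → EuclideanSpace ℝ (Fin 3) → EuclideanSpace ℝ (Fin 3)⦄
      ⦃p : ℝ → EuclideanSpace ℝ (Fin 3) → ℝ⦄, 0 < F → F ≤ Tw →
      IsTaoSolutionOn F ν u₀ u p → ∀ t ∈ Icc 0 F,
        (∫⁻ x, ‖u t x‖ₑ ^ 2) + (∫⁻ x, ENNReal.ofReal (frobeniusNormSq (fderiv ℝ (u t) x))) ≤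
          ENNReal.ofReal (A + 1) := by
    intro F u p hF hFw h t ht
    have hae : ∀ s ∈ Icc 0 F, u s =ᵐ[volume] w s :=
      h.ae_eq_of_kato_Icc hν hF (hwmild F) (hwc (Icc 0 F) Icc_subset_Ici_self) (hwm F)
    have htail : ∀ s ∈ Icc 0 F,
        eLpNorm ({x | lam ≤ ‖w s x‖₊}.indicator (w s)) 3 volume ≤ ENNReal.ofReal δ₀ :=
      fun s hs => hlam s ⟨hs.1, hs.2.trans hFw⟩
    have hens_t := h.enstrophy_le_of_tails hF hens hae htail t ht
    have hener := h.lintegral_enorm_sq_le hF hν.le ht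
    have hexp : Real.exp (2 * M ^ 2 * t / ν) ≤ Real.exp (2 * M ^ 2 * Tw / ν) := by
      refine Real.exp_le_exp.2 (div_le_div_of_nonneg_right ?_ hν.le)
      exact mul_le_mul_of_nonneg_left (ht.2.trans hFw) (by positivity)
    calc (∫⁻ x, ‖u t x‖ₑ ^ 2) + (∫⁻ x, ENNReal.ofReal (frobeniusNormSq (fderiv ℝ (u t) x)))
        ≤ ENNReal.ofReal e₀ + ENNReal.ofReal (Real.exp (2 * M ^ 2 * t / ν)) *
            ∫⁻ x, ENNReal.ofReal (frobeniusNormSq (fderiv ℝ u₀ x)) := add_le_add hener hens_t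
      _ ≤ ENNReal.ofReal e₀ + ENNReal.ofReal (Real.exp (2 * M ^ 2 * Tw / ν)) * ENNReal.ofReal g₀ := by
          rw [hg₀eq]; gcongr
      _ = ENNReal.ofReal A := by
          rw [hA, ← ENNReal.ofReal_mul (Real.exp_nonneg _), ← ENNReal.ofReal_add he₀0 (by positivity)]
      _ ≤ ENNReal.ofReal (A + 1) := ENNReal.ofReal_le_ofReal (by linarith)
  /- the restart step -/
  have hstep : ∀ ⦃F : ℝ⦄ ⦃u : ℝ → EuclideanSpace ℝ (Fin 3) → EuclideanSpace ℝ (Fin 3)⦄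
      ⦃p : ℝ → EuclideanSpace ℝ (Fin 3) → ℝ⦄, 0 < F → F ≤ Tt →
      IsTaoSolutionOn F ν u₀ u p →
      ∃ (F' : ℝ) (u' : ℝ → EuclideanSpace ℝ (Fin 3) → EuclideanSpace ℝ (Fin 3))
        (p' : ℝ → EuclideanSpace ℝ (Fin 3) → ℝ), F + τ / 2 ≤ F' ∧ F' ≤ F + τ ∧
        IsTaoSolutionOn F' ν u₀ u' p' := by
    intro F u p hF hFT h
    set t' : ℝ := max (F / 2) (F - τ / 4) with ht'
    have ht'0 : 0 ≤ t' := le_max_of_le_left (by linarith)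
    have ht'F : t' < F := max_lt (by linarith) (by linarith)
    have hFt' : F ≤ t' + τ := by linarith [le_max_right (F / 2) (F - τ / 4)]
    have ht'I : t' ∈ Icc 0 F := ⟨ht'0, ht'F.le⟩
    obtain ⟨hsm', hdiv', hH'⟩ := h.slice ht'I
    have hbound := hkey hF (hFT.trans hTtw.le) h t' ht'I
    obtain ⟨v, q, hv⟩ := hloc hν hτpos hsm' hdiv' hH' hA1 hbound hτc
    refine ⟨t' + τ, _, _, by linarith [le_max_right (F / 2) (F - τ / 4)], by linarith,
      h.glue hv hν hτpos ht'0 ht'F hFt'⟩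
  /- the first patch, from the Schwartz datum -/
  have hbase : ∃ (F : ℝ) (u : ℝ → EuclideanSpace ℝ (Fin 3) → EuclideanSpace ℝ (Fin 3))
      (p : ℝ → EuclideanSpace ℝ (Fin 3) → ℝ),
      IsTaoSolutionOn F ν u₀ u p ∧ 0 < F ∧ F ≤ Tw := by
    have hdat0 : ∫⁻ x, ‖u₀ x‖ₑ ^ 2 < ⊤ := by
      refine lt_of_le_of_lt (le_of_eq (lintegral_congr fun x => ?_)) (hHinf 0)
      rw [← ofReal_norm, ← ofReal_norm, norm_iteratedFDeriv_zero]
    set A₀ : ℝ := ((∫⁻ x, ‖u₀ x‖ₑ ^ 2) +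
      ∫⁻ x, ENNReal.ofReal (frobeniusNormSq (fderiv ℝ u₀ x))).toReal with hA₀
    have hA₀0 : 0 ≤ A₀ := ENNReal.toReal_nonneg
    have hA₀eq : (∫⁻ x, ‖u₀ x‖ₑ ^ 2) + ∫⁻ x, ENNReal.ofReal (frobeniusNormSq (fderiv ℝ u₀ x))
        ≤ ENNReal.ofReal A₀ := by
      rw [hA₀, ENNReal.ofReal_toReal (ENNReal.add_ne_top.2 ⟨hdat0.ne, hG₀.ne⟩)]
    set T₀ : ℝ := min 1 (c * ν ^ 3 / (A₀ ^ 2 + 1)) with hT₀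
    have hT₀pos : 0 < T₀ := lt_min one_pos (by positivity)
    have hT₀c : A₀ ^ 2 * T₀ ≤ c * ν ^ 3 := by
      calc A₀ ^ 2 * T₀ ≤ A₀ ^ 2 * (c * ν ^ 3 / (A₀ ^ 2 + 1)) :=
            mul_le_mul_of_nonneg_left (min_le_right _ _) (sq_nonneg _)
        _ = c * ν ^ 3 * (A₀ ^ 2 / (A₀ ^ 2 + 1)) := by ring
        _ ≤ c * ν ^ 3 * 1 :=
            mul_le_mul_of_nonneg_left (by rw [div_le_one (by positivity)]; linarith) (by positivity)
        _ = c * ν ^ 3 := mul_one _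
    obtain ⟨u, p, h⟩ := hloc hν hT₀pos hsm hdiv hHinf hA₀0 hA₀eq hT₀c
    exact ⟨T₀, u, p, h, hT₀pos, (min_le_left _ _).trans (by rw [hTw]; linarith)⟩
  /- the induction -/
  have hiter : ∀ k : ℕ, ∃ (F : ℝ) (u : ℝ → EuclideanSpace ℝ (Fin 3) → EuclideanSpace ℝ (Fin 3))
      (p : ℝ → EuclideanSpace ℝ (Fin 3) → ℝ),
      IsTaoSolutionOn F ν u₀ u p ∧ 0 < F ∧ F ≤ Tw ∧ (Tt ≤ F ∨ (k : ℝ) * (τ / 2) ≤ F) := by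
    intro k
    induction k with
    | zero =>
      obtain ⟨F, u, p, h, hF, hFw⟩ := hbase
      exact ⟨F, u, p, h, hF, hFw, Or.inr (by simpa using hF.le)⟩
    | succ k ih =>
      obtain ⟨F, u, p, h, hF, hFw, halt⟩ := ih
      rcases le_or_gt Tt F with hdone | hlt
      · exact ⟨F, u, p, h, hF, hFw, Or.inl hdone⟩
      · obtain ⟨F', u', p', h1, h2, h'⟩ := hstep hF hlt.le h
        refine ⟨F', u', p', h', by linarith, ?_, ?_⟩
        · rw [hTw]; linarith
        · rcases halt with hd | hk
          · exact absurd hd (not_le.2 hlt)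
          · right
            push_cast
            linarith
  obtain ⟨k, hk⟩ := exists_nat_gt (Tw / (τ / 2))
  obtain ⟨F, u, p, h, hF, hFw, halt⟩ := hiter k
  have hTtF : Tt ≤ F := by
    rcases halt with hd | hk'
    · exact hd
    · exfalso
      have h2 : Tw < (k : ℝ) * (τ / 2) := by rwa [div_lt_iff₀ (by positivity)] at hk
      linarith
  exact ⟨u, p, h.mono hTt hTtF⟩

/-! ### The assembly -/

/-- **A global Kato solution from a Clay datum is a Clay-class solution — from Tao's local
existence theorem.** `tao2011_smooth_local_existence → clay_solution_of_hasGlobalKatoSolution`: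
given Tao 2013, Thm. 5.4 (ii)+(iv) (`TaoH1LocalExistence.lean`), for `ν > 0` and `u₀` smooth,
divergence free and rapidly decaying with a global Kato solution there are jointly smooth `u`,
`p` on `ℝ³ × [0, ∞)` solving the Navier–Stokes system with datum `u₀` and with bounded energy.
Proof: by `exists_isTaoSolutionOn_of_hasGlobalKatoSolution` choose Tao-class solutions
`(Uₙ, Pₙ)` on `[0, n + 1]`, `n ∈ ℕ`; any two agree on the common slab (velocities by
Prodi–Serrin, `IsTaoSolutionOn.eq_of_isTaoSolutionOn`; pressures by
`IsTaoSolutionOn.pressure_eq`, no renormalisation), so `u t = U_{⌈t⌉} t`, `p t = P_{⌈t⌉} t`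
define a classical solution on `[0, ∞)` (smoothness and the one-sided momentum equation are
local in time), `u 0 = u₀`, and `∫ |u(t)|² ≤ ∫ |u₀|²` by the energy inequality of each patch;
the bridge `isNavierStokesSolution_and_smooth_iff` converts to Fefferman's (1)–(3), (6), (7).
Every ingredient except Tao's theorem is proved in the tree (uniqueness in `C_tL³`:
`kato_unique_holds`; weak–strong uniqueness: `serrin_weak_strong_uniqueness_holds`; the
enstrophy inequality under splitting: `enstrophy_le_mul_exp_of_split`; classical ⇒ mild:
`IsClassicalNSSolutionOn.isMildNSSolutionOn_holds`).
[cite: LemarieRieusset2016, Prop. 12.3 (von Wahl) with Thm. 7.2 and Thm. 7.7, PDF pp. 147, 169, 393] -/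
theorem clay_solution_of_hasGlobalKatoSolution_of_tao (hE : tao2011_smooth_local_existence) :
    clay_solution_of_hasGlobalKatoSolution := by
  intro ν hν u₀ hsm hdiv hdec hK
  have hdiv' : VectorCalculus.IsDivFree u₀ := fun x => hdiv x
  have hex : ∀ n : ℕ, ∃ (u : ℝ → EuclideanSpace ℝ (Fin 3) → EuclideanSpace ℝ (Fin 3))
      (p : ℝ → EuclideanSpace ℝ (Fin 3) → ℝ),
      IsTaoSolutionOn ((n : ℝ) + 1) ν u₀ u p := fun n =>
    exists_isTaoSolutionOn_of_hasGlobalKatoSolution hE hν hsm hdiv' hdec hK (by positivity)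
  choose U P hUP using hex
  have hpos : ∀ n : ℕ, (0 : ℝ) < (n : ℝ) + 1 := fun n => by positivity
  -- any two patches agree on the common slab
  have hagree : ∀ m n : ℕ, ∀ t ∈ Ico (0 : ℝ) (min ((m : ℝ) + 1) ((n : ℝ) + 1)), U m t = U n t :=
    fun m n => (hUP m).eq_of_isTaoSolutionOn (hUP n) hν (hpos m) (hpos n)
  -- the index `⌈t⌉` and the patched fields
  have hceil : ∀ {t : ℝ}, 0 ≤ t → t ∈ Ico (0 : ℝ) ((⌈t⌉₊ : ℝ) + 1) := fun {t} ht =>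
    ⟨ht, lt_of_le_of_lt (Nat.le_ceil t) (lt_add_one _)⟩
  set u : ℝ → EuclideanSpace ℝ (Fin 3) → EuclideanSpace ℝ (Fin 3) := fun t => U ⌈t⌉₊ t with hu
  set p : ℝ → EuclideanSpace ℝ (Fin 3) → ℝ := fun t => P ⌈t⌉₊ t with hp
  have hloc_u : ∀ n : ℕ, ∀ t ∈ Ico (0 : ℝ) ((n : ℝ) + 1), u t = U n t := fun n t ht =>
    hagree ⌈t⌉₊ n t ⟨ht.1, lt_min (hceil ht.1).2 ht.2⟩
  have hloc_p : ∀ n : ℕ, ∀ t ∈ Ico (0 : ℝ) ((n : ℝ) + 1), p t = P n t := by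
    intro n t ht
    set m : ℝ := (t + min ((⌈t⌉₊ : ℝ) + 1) ((n : ℝ) + 1)) / 2 with hm
    have htlt : t < min ((⌈t⌉₊ : ℝ) + 1) ((n : ℝ) + 1) := lt_min (hceil ht.1).2 ht.2
    have htm : t ≤ m := by rw [hm]; linarith
    have hmlt : m < min ((⌈t⌉₊ : ℝ) + 1) ((n : ℝ) + 1) := by rw [hm]; linarith
    have hm0 : 0 < m := lt_of_le_of_lt ht.1 (by rw [hm]; linarith)
    exact (hUP ⌈t⌉₊).pressure_eq (hUP n) hm0 (hmlt.le.trans (min_le_left _ _))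
      (hmlt.le.trans (min_le_right _ _))
      (fun s hs => hagree ⌈t⌉₊ n s ⟨hs.1, hs.2.trans_lt hmlt⟩) t ⟨ht.1, htm⟩
  -- set identities for the local arguments
  have hIci : ∀ b : ℝ, Ici (0 : ℝ) ∩ Iio b = Icc 0 b ∩ Iio b := fun b => Set.ext fun s => by
    simp only [mem_inter_iff, mem_Ici, mem_Icc, mem_Iio]
    exact ⟨fun h => ⟨⟨h.1, h.2.le⟩, h.2⟩, fun h => ⟨h.1.1, h.2⟩⟩
  -- joint smoothness of the patched fields (local)
  have hsmooth : ∀ {F : Type} [NormedAddCommGroup F] [NormedSpace ℝ F]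
      {g : ℝ → EuclideanSpace ℝ (Fin 3) → F} {G : ℕ → ℝ → EuclideanSpace ℝ (Fin 3) → F},
      (∀ n : ℕ, IsSmoothSpaceTimeOn (Icc 0 ((n : ℝ) + 1)) (G n)) →
      (∀ n : ℕ, ∀ t ∈ Ico (0 : ℝ) ((n : ℝ) + 1), g t = G n t) →
      IsSmoothSpaceTimeOn (Ici 0) g := by
    intro F _ _ g G hG hgG
    refine contDiffOn_of_locally_contDiffOn fun z hz => ?_
    obtain ⟨t, x⟩ := z
    have ht : 0 ≤ t := hz.1
    set n : ℕ := ⌈t⌉₊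
    have hlt : t < (n : ℝ) + 1 := (hceil ht).2
    refine ⟨Iio ((n : ℝ) + 1) ×ˢ univ, isOpen_Iio.prod isOpen_univ, ⟨hlt, mem_univ _⟩, ?_⟩
    rw [prod_inter_prod, univ_inter, hIci]
    refine ContDiffOn.congr ((hG n).mono inter_subset_left) fun z hz => ?_
    obtain ⟨τ, y⟩ := z
    have hτ : τ ∈ Ico (0 : ℝ) ((n : ℝ) + 1) := ⟨hz.1.1.1, hz.1.2⟩
    simp only [uncurry_apply_pair, hgG n τ hτ]
  have hcl : IsClassicalNSSolutionOn (Ici 0) ν 0 u p := by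
    refine ⟨hsmooth (fun n => (hUP n).classical.smooth_velocity) hloc_u,
      hsmooth (fun n => (hUP n).classical.smooth_pressure) hloc_p, ?_, ?_⟩
    · -- momentum, with the one-sided derivative within `[0, ∞)`
      intro t ht x
      have ht0 : 0 ≤ t := ht
      set n : ℕ := ⌈t⌉₊ with hn
      have hlt : t < (n : ℝ) + 1 := (hceil ht0).2
      have htI : t ∈ Icc (0 : ℝ) ((n : ℝ) + 1) := ⟨ht0, hlt.le⟩
      have hev : (fun s => u s x) =ᶠ[𝓝[Ici 0] t] fun s => U n s x := by
        filter_upwards [inter_mem_nhdsWithin (Ici (0 : ℝ)) (Iio_mem_nhds hlt)] with s hs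
        rw [hloc_u n s ⟨hs.1, hs.2⟩]
      have hD : timeDerivWithin (Ici 0) u t x = timeDerivWithin (Icc 0 ((n : ℝ) + 1)) (U n) t x := by
        simp only [timeDerivWithin_apply]
        rw [hev.derivWithin_eq (by rw [hloc_u n t ⟨ht0, hlt⟩]),
          ← derivWithin_inter (Iio_mem_nhds hlt), hIci, derivWithin_inter (Iio_mem_nhds hlt)]
      rw [hD]
      exact (hUP n).classical.momentum t htI x
    · intro t ht
      exact (hUP ⌈t⌉₊).classical.divFree t ⟨ht, (hceil ht).2.le⟩
  have h0 : u 0 = u₀ := (hUP ⌈(0 : ℝ)⌉₊).initial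
  have hEn : HasBoundedEnergy u :=
    ⟨ENNReal.ofReal (2 * VectorCalculus.kineticEnergy u₀), ENNReal.ofReal_lt_top, fun t ht =>
      (hUP ⌈t⌉₊).lintegral_enorm_sq_le (hpos _) hν.le ⟨ht, (hceil ht).2.le⟩⟩
  obtain ⟨hns, hsu, hsp⟩ := isNavierStokesSolution_and_smooth_iff.2 ⟨hcl, h0⟩
  exact ⟨u, p, hsu, hsp, hns, hEn⟩

end Literature.Analysis.FluidPDE

end
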